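import Summits.Langlands.Langlands.Theorems.SoloInformedWittDigitIdeals
import Literature.NumberTheory.PAdicHodge.TiltUntiltDivisibility
import Literature.NumberTheory.PAdicHodge.AinfAdicComplete

/-!
# The digit norm of the tilt `𝒪_{ℂ_F}♭` and the ideals `(p, ξ)^M` of `𝔸_inf(F)` (solo programme, s78)

The tilt `R = 𝒪_{ℂ_F}♭` carries the valuation `v(x) = ‖x♯‖` (Mathlib `PreTilt.val`), for which it is a
valuation ring (`exists_eq_mul_of_norm_untilt_le`); with the base `ϱ = ‖p‖ = v(p♭)` this is a `DigitNorm`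
(`tiltDigitNorm`), and the generic digit calculus gives
`a ∈ (p, ξ)^M = (p, [p♭])^M ↔ DigitLE ϱ^M a` on `𝔸_inf(F) = W(R)` (`mem_span_p_xi_pow_iff_digitLE`). [folklore]
-/

noncomputable section

namespace Summit.Langlands.Langlands.Theorems.AinfDigits

open WittVector NNReal
open Literature.NumberTheory.PAdicHodge
open Literature.NumberTheory.GaloisRepresentations
open Literature.NumberTheory.GaloisRepresentations.IsNonarchimedeanLocalField
open Summit.Langlands.Langlands.Theorems.WittDigits

variable {F : Type} [Field F] [ValuativeRel F] [TopologicalSpace F] [IsNonarchimedeanLocalField F]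
  {p : ℕ} [Fact p.Prime] [Fact (¬ IsUnit (p : integerC F))] [IsAdicComplete (Ideal.span {(p : integerC F)}) (integerC F)]

variable (F p) in
/-- **The valuation `x ↦ ‖x♯‖` of the tilt `𝒪_{ℂ_F}♭`** (Mathlib's `PreTilt.val` for the norm of `ℂ_F`).
[cite: FontaineOuyang2022, Prop. 4.3.3] -/
def tiltVal : Valuation (PreTilt (integerC F) p) ℝ≥0 :=
  PreTilt.val (CompletedAlgClosure F) NormedField.valuation (integerC F) integers_integerC p

/-- `0♯ = 0`. [folklore] -/
theorem untilt_zero : PreTilt.untilt (0 : PreTilt (integerC F) p) = 0 := by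
  change Perfection.teichmuller p (Ideal.span {(p : integerC F)}) 0 = 0
  exact Perfection.teichmuller_zero

/-- **`v(x) = ‖x♯‖`** (the value of `PreTilt.val` is the norm of the untilt). [cite: FontaineOuyang2022, Prop. 4.3.3] -/
theorem tiltVal_apply (x : PreTilt (integerC F) p) :
    tiltVal F p x = ‖((PreTilt.untilt x : integerC F) : CompletedAlgClosure F)‖₊ := by
  by_cases hx : x = 0
  · subst hx
    rw [Valuation.map_zero, untilt_zero, ZeroMemClass.coe_zero, nnnorm_zero]
  · obtain ⟨n, hn⟩ : ∃ n, PreTilt.coeff n x ≠ 0 := not_forall.1 fun h => hx (Perfection.ext h)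
    change PreTilt.valAux (CompletedAlgClosure F) NormedField.valuation (integerC F) p x = _
    rw [PreTilt.valAux_eq integers_integerC hn]
    rw [← mk_untilt_frobeniusEquiv_symm x n] at hn ⊢
    rw [ModP.preVal_mk integers_integerC hn]
    change NormedField.valuation (((PreTilt.untilt (((frobeniusEquiv (PreTilt (integerC F) p) p).symm^[n]) x) :
      integerC F) : CompletedAlgClosure F)) ^ p ^ n = _
    rw [NormedField.valuation_apply, ← NNReal.coe_inj, NNReal.coe_pow, coe_nnnorm, coe_nnnorm]
    exact norm_untilt_frobeniusEquiv_symm_pow x n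

/-- `v(x) = ‖x♯‖` in `ℝ`. [folklore] -/
theorem coe_tiltVal_apply (x : PreTilt (integerC F) p) :
    (tiltVal F p x : ℝ) = ‖((PreTilt.untilt x : integerC F) : CompletedAlgClosure F)‖ := by
  rw [tiltVal_apply, coe_nnnorm]

/-- `v ≤ 1`. [folklore] -/
theorem tiltVal_le_one (x : PreTilt (integerC F) p) : tiltVal F p x ≤ 1 := by
  rw [← NNReal.coe_le_coe, coe_tiltVal_apply]; exact norm_coe_integerC_le _

/-- **`𝒪_{ℂ_F}♭` is a valuation ring for `v`**: `v(x) ≤ v(y) ⇒ y ∣ x`. [cite: FontaineOuyang2022, Prop. 4.3.3] -/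
theorem dvd_of_tiltVal_le {x y : PreTilt (integerC F) p} (h : tiltVal F p x ≤ tiltVal F p y) : y ∣ x := by
  by_cases hy : ((PreTilt.untilt y : integerC F) : CompletedAlgClosure F) = 0
  · have hy0 : tiltVal F p y = 0 := by rw [tiltVal_apply, hy, nnnorm_zero]
    have hx0 : x = 0 :=
      (PreTilt.map_eq_zero integers_integerC).1 (by change tiltVal F p x = 0; exact le_antisymm (hy0 ▸ h) zero_le)
    rw [hx0]; exact dvd_zero y
  · have h' : ‖((PreTilt.untilt x : integerC F) : CompletedAlgClosure F)‖ ≤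
        ‖((PreTilt.untilt y : integerC F) : CompletedAlgClosure F)‖ := by
      rw [← coe_tiltVal_apply, ← coe_tiltVal_apply]; exact_mod_cast h
    obtain ⟨c, hc⟩ := exists_eq_mul_of_norm_untilt_le hy h'
    exact ⟨c, hc⟩

/-- **`v(p♭) = ‖p‖`.** [cite: FontaineAsterisque223III, Exp. II §1.2.2] -/
theorem tiltVal_pFlat : tiltVal F p pFlat = ‖(p : CompletedAlgClosure F)‖₊ := by
  rw [tiltVal_apply, untilt_pFlat, coe_natCast_integerC]

variable [CharZero F]

variable (F p) in
/-- **The digit norm of the tilt**: `v(x) = ‖x♯‖`, base `ϱ = ‖p‖ ∈ (0, 1)`. [folklore] -/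
def tiltDigitNorm : DigitNorm (PreTilt (integerC F) p) where
  v := tiltVal F p
  rho := ‖(p : CompletedAlgClosure F)‖₊
  le_one := tiltVal_le_one
  dvd_of_le := dvd_of_tiltVal_le
  rho_pos := by
    rw [pos_iff_ne_zero, ne_eq, nnnorm_eq_zero]; exact natCast_C_ne_zero (Fact.out : p.Prime).ne_zero
  rho_lt_one := by rw [← NNReal.coe_lt_coe, coe_nnnorm]; exact norm_natCast_C_lt_one'

/-- The valuation of `tiltDigitNorm`. [folklore] -/
theorem tiltDigitNorm_v : (tiltDigitNorm F p).v = tiltVal F p := rfl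

/-- The base of `tiltDigitNorm`. [folklore] -/
theorem tiltDigitNorm_rho : (tiltDigitNorm F p).rho = ‖(p : CompletedAlgClosure F)‖₊ := rfl

/-- `v(p♭) = ϱ`. [folklore] -/
theorem tiltDigitNorm_v_pFlat : (tiltDigitNorm F p).v pFlat = (tiltDigitNorm F p).rho := tiltVal_pFlat

/-- **`a ∈ (p, ξ)^M ↔ DigitLE ϱ^M a`**: the `(p, ξ)`-adic filtration of `𝔸_inf(F)` is read off the Witt digits
(`(p, ξ) = (p, [p♭])`, `v(p♭) = ϱ`). [cite: FontaineAsterisque223III, Exp. II §1.3] -/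
theorem mem_span_p_xi_pow_iff_digitLE (M : ℕ) (a : Ainf (p := p) F) :
    a ∈ Ideal.span {(p : Ainf (p := p) F), xi} ^ M ↔ DigitLE (tiltDigitNorm F p) ((tiltDigitNorm F p).rho ^ M) a := by
  rw [span_p_xi_eq]
  exact mem_pow_iff_digitLE tiltDigitNorm_v_pFlat M a

/-- A threshold `t` with `DigitLE t a` for `a ∉ (p, ξ)^M` exceeds `ϱ^M`. [folklore] -/
theorem rho_pow_lt_of_not_mem {M : ℕ} {a : Ainf (p := p) F} {t : ℝ≥0}
    (ha : a ∉ Ideal.span {(p : Ainf (p := p) F), xi} ^ M) (ht : DigitLE (tiltDigitNorm F p) t a) :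
    (tiltDigitNorm F p).rho ^ M < t :=
  lt_of_not_ge fun h => ha ((mem_span_p_xi_pow_iff_digitLE M a).2 (ht.mono h))

end Summit.Langlands.Langlands.Theorems.AinfDigits
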